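import Mathlib
import Summits.ValiantsHypothesis.ValiantsHypothesis.Theorems.RigidityForcesSymmetryRankRigidMinimalReprLaplaceFiveSeparatedCaptureCoordSlices

/-!
# Slice chains: counting captured obligations by successive coordinate slices

Sharper forms of the two-slice count (✓ `finrank_le_of_two_slices`) for the 3-slot capture inequality `CaptureIneqSym`
(sub-problem `LaplaceOptimalFive`, item 24813 — which stays OPEN; nothing here claims it).

An obligation `T_μ = contractZ μ` is a square-free fully symmetric 3-tensor; its coordinate slice at a letter `c` is the
symmetric zero-diagonal matrix `(p, q) ↦ T_μ p q c`, with row and column `c` zero.  We prove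

* the ONE-STEP COUNT `finrank W ≤ finrank Y + finrank W'` whenever the `c`-slices of `W` lie in `Y` and the obligations with
  vanishing `c`-slice lie in `W'` (range + kernel);
* the TWO-LETTER CHAIN `finrank W ≤ finrank Y₁ + finrank Y₂ + 1`, where `Y₂` only has to contain the `c₂`-slices of the
  obligations whose `c₁`-slice VANISHES (so `Y₂` may be cut down to matrices with rows `c₁, c₂` zero);
* the THREE-LETTER CHAIN `finrank W ≤ finrank Y₁ + finrank Y₂ + finrank Y₃` (three slices see every square-free triple);
* the feeding lemmas: the shape of a coordinate slice (symmetric, zero diagonal, row `c` zero, and row `c₁` zero once the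
  `c₁`-slice vanishes), and the resulting counts for a slot all of whose matrices have two (resp. three) zero rows — e.g. a
  line `ℂu` with `u` supported on three (resp. two) letters — with the other two spans ARBITRARY.

All statements are [folklore] linear algebra; the case analysis they feed (profiles `(1,2,3)`, `(2,2,3)` of `CaptureIneqSym`)
is recorded in the cell's notes, not claimed here.
-/

set_option linter.dupNamespace false
set_option autoImplicit false

namespace Summit.ValiantsHypothesis.ValiantsHypothesis.Theorems.RigidityForcesSymmetryRankRigidMinimalRepr

namespace LaplaceFiveSeparatedCapture

open Finset

/-! ### The shape of a coordinate slice -/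

/-- A coordinate slice `(p, q) ↦ T_μ p q c` of an obligation is symmetric, has zero diagonal, and its row and column `c`
vanish. [folklore] -/
theorem sliceCoord_shape (μ : Fin 5 → Fin 5 → ℂ) (c : Fin 5) :
    (∀ p q : Fin 5, contractZ μ p q c = contractZ μ q p c) ∧ (∀ p : Fin 5, contractZ μ p p c = 0) ∧
      (∀ q : Fin 5, contractZ μ c q c = 0) ∧ (∀ q : Fin 5, contractZ μ q c c = 0) := by
  refine ⟨fun p q => (contractZ_swap12 μ q p c), fun p => contractZ_rep12 μ p c, fun q => ?_, fun q => ?_⟩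
  · rw [contractZ_swap23 μ c c q]; exact contractZ_rep12 μ c q
  · rw [contractZ_swap12 μ c q c, contractZ_swap23 μ c c q]; exact contractZ_rep12 μ c q

/-- Once the `c₁`-slice of an obligation vanishes, the row `c₁` of every other coordinate slice vanishes too. [folklore] -/
theorem sliceCoord_row_eq_zero_of_slice_eq_zero (μ : Fin 5 → Fin 5 → ℂ) (c₁ c : Fin 5)
    (h : (fun p q => contractZ μ p q c₁) = 0) (q : Fin 5) : contractZ μ c₁ q c = 0 := by
  have h' : contractZ μ q c c₁ = 0 := congrFun (congrFun h q) c
  rw [contractZ_swap12 μ q c₁ c, contractZ_swap23 μ q c c₁]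
  exact h'

/-! ### One slice step: range plus kernel -/

/-- ★ **SLICE STEP.**  If the `c`-slices of the obligations of `W` lie in `Y`, and every `μ ∈ W` whose `c`-slice vanishes lies in
`W'`, then `finrank W ≤ finrank Y + finrank W'`. [folklore] -/
theorem finrank_le_of_slice_step (W W' Y : Submodule ℂ (Fin 5 → Fin 5 → ℂ)) (c : Fin 5)
    (hY : ∀ μ ∈ W, (fun p q => contractZ μ p q c) ∈ Y)
    (hW' : ∀ μ ∈ W, (fun p q => contractZ μ p q c) = 0 → μ ∈ W') :
    Module.finrank ℂ W ≤ Module.finrank ℂ Y + Module.finrank ℂ W' := by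
  let sl : (Fin 5 → Fin 5 → Fin 5 → ℂ) →ₗ[ℂ] (Fin 5 → Fin 5 → ℂ) :=
    { toFun := fun T p q => T p q c, map_add' := fun _ _ => rfl, map_smul' := fun _ _ => rfl }
  let Ψ : W →ₗ[ℂ] (Fin 5 → Fin 5 → ℂ) := (sl.comp cZ).domRestrict W
  have hΨ : ∀ μ : W, Ψ μ = fun p q => contractZ μ.1 p q c := fun μ => rfl
  have hrange : LinearMap.range Ψ ≤ Y := by
    rintro _ ⟨μ, rfl⟩
    rw [hΨ]
    exact hY μ.1 μ.2
  have hr : Module.finrank ℂ (LinearMap.range Ψ) ≤ Module.finrank ℂ Y := Submodule.finrank_mono hrange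
  -- the kernel injects into `W'`
  let ι : LinearMap.ker Ψ →ₗ[ℂ] (Fin 5 → Fin 5 → ℂ) := W.subtype.comp (LinearMap.ker Ψ).subtype
  have hι : Function.Injective ι := fun x y hxy => Subtype.ext (Subtype.ext hxy)
  have hιr : LinearMap.range ι ≤ W' := by
    rintro _ ⟨x, rfl⟩
    have h0 := LinearMap.mem_ker.mp x.2
    rw [hΨ] at h0
    exact hW' _ x.1.2 h0
  have hk : Module.finrank ℂ (LinearMap.ker Ψ) ≤ Module.finrank ℂ W' := by
    rw [← LinearMap.finrank_range_of_inj hι]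
    exact Submodule.finrank_mono hιr
  have hrn := LinearMap.finrank_range_add_finrank_ker Ψ
  omega

/-! ### Chains of two and three letters -/

/-- ★★ **TWO-LETTER SLICE CHAIN.**  If the `c₁`-slices of the obligations of `W` lie in `Y₁`, and the `c₂`-slices of those
obligations WHOSE `c₁`-SLICE VANISHES lie in `Y₂`, then `finrank W ≤ finrank Y₁ + finrank Y₂ + 1` (the letters `c₁, c₂, a, b, e`
exhaust `Fin 5`; the `1` is the word `(a, b, e)`). [folklore] -/
theorem finrank_le_of_two_slices_chain (W Y₁ Y₂ : Submodule ℂ (Fin 5 → Fin 5 → ℂ))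
    (hWs : ∀ μ ∈ W, ∀ s t : Fin 5, μ s t = μ t s) (hWd : ∀ μ ∈ W, ∀ s : Fin 5, μ s s = 0)
    (c₁ c₂ a b e : Fin 5) (hcov : ∀ x : Fin 5, x = c₁ ∨ x = c₂ ∨ x = a ∨ x = b ∨ x = e)
    (hY₁ : ∀ μ ∈ W, (fun p q => contractZ μ p q c₁) ∈ Y₁)
    (hY₂ : ∀ μ ∈ W, (fun p q => contractZ μ p q c₁) = 0 → (fun p q => contractZ μ p q c₂) ∈ Y₂) :
    Module.finrank ℂ W ≤ Module.finrank ℂ Y₁ + Module.finrank ℂ Y₂ + 1 := by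
  let sl : (Fin 5 → Fin 5 → Fin 5 → ℂ) →ₗ[ℂ] (Fin 5 → Fin 5 → ℂ) :=
    { toFun := fun T p q => T p q c₁, map_add' := fun _ _ => rfl, map_smul' := fun _ _ => rfl }
  let W' : Submodule ℂ (Fin 5 → Fin 5 → ℂ) := W ⊓ LinearMap.ker (sl.comp cZ)
  have hW'mem : ∀ μ : Fin 5 → Fin 5 → ℂ, μ ∈ W' ↔ μ ∈ W ∧ (fun p q => contractZ μ p q c₁) = 0 := fun μ => Iff.rfl
  have h1 := finrank_le_of_slice_step W W' Y₁ c₁ hY₁ (fun μ hμ h0 => (hW'mem μ).mpr ⟨hμ, h0⟩)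
  have h2 : Module.finrank ℂ W' ≤ Module.finrank ℂ (⊥ : Submodule ℂ (Fin 5 → Fin 5 → ℂ)) + Module.finrank ℂ Y₂ + 1 :=
    finrank_le_of_two_slices W' (fun μ hμ => hWs μ ((hW'mem μ).mp hμ).1) (fun μ hμ => hWd μ ((hW'mem μ).mp hμ).1)
      c₁ c₂ a b e hcov ⊥ Y₂
      (fun μ hμ => by rw [((hW'mem μ).mp hμ).2]; exact Submodule.zero_mem _)
      (fun μ hμ => hY₂ μ ((hW'mem μ).mp hμ).1 ((hW'mem μ).mp hμ).2)
  rw [finrank_bot] at h2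
  omega

/-- ★★ **THREE-LETTER SLICE CHAIN.**  With three letters `c₁, c₂, c₃` (and `a, b` the remaining two) and nested hypotheses — `Y₂`
sees only the obligations killed at `c₁`, `Y₃` only those killed at `c₁` and `c₂` — `finrank W ≤ finrank Y₁ + finrank Y₂ + finrank Y₃`:
three coordinate slices see every square-free word. [folklore] -/
theorem finrank_le_of_three_slices_chain (W Y₁ Y₂ Y₃ : Submodule ℂ (Fin 5 → Fin 5 → ℂ))
    (hWs : ∀ μ ∈ W, ∀ s t : Fin 5, μ s t = μ t s) (hWd : ∀ μ ∈ W, ∀ s : Fin 5, μ s s = 0)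
    (c₁ c₂ c₃ a b : Fin 5) (hcov : ∀ x : Fin 5, x = c₁ ∨ x = c₂ ∨ x = a ∨ x = b ∨ x = c₃)
    (hY₁ : ∀ μ ∈ W, (fun p q => contractZ μ p q c₁) ∈ Y₁)
    (hY₂ : ∀ μ ∈ W, (fun p q => contractZ μ p q c₁) = 0 → (fun p q => contractZ μ p q c₂) ∈ Y₂)
    (hY₃ : ∀ μ ∈ W, (fun p q => contractZ μ p q c₁) = 0 → (fun p q => contractZ μ p q c₂) = 0 →
      (fun p q => contractZ μ p q c₃) ∈ Y₃) :
    Module.finrank ℂ W ≤ Module.finrank ℂ Y₁ + Module.finrank ℂ Y₂ + Module.finrank ℂ Y₃ := by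
  let sl : Fin 5 → ((Fin 5 → Fin 5 → Fin 5 → ℂ) →ₗ[ℂ] (Fin 5 → Fin 5 → ℂ)) := fun c =>
    { toFun := fun T p q => T p q c, map_add' := fun _ _ => rfl, map_smul' := fun _ _ => rfl }
  let W₁ : Submodule ℂ (Fin 5 → Fin 5 → ℂ) := W ⊓ LinearMap.ker ((sl c₁).comp cZ)
  let W₂ : Submodule ℂ (Fin 5 → Fin 5 → ℂ) := W₁ ⊓ LinearMap.ker ((sl c₂).comp cZ)
  let W₃ : Submodule ℂ (Fin 5 → Fin 5 → ℂ) := W₂ ⊓ LinearMap.ker ((sl c₃).comp cZ)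
  have hm₁ : ∀ μ : Fin 5 → Fin 5 → ℂ, μ ∈ W₁ ↔ μ ∈ W ∧ (fun p q => contractZ μ p q c₁) = 0 := fun μ => Iff.rfl
  have hm₂ : ∀ μ : Fin 5 → Fin 5 → ℂ, μ ∈ W₂ ↔ μ ∈ W₁ ∧ (fun p q => contractZ μ p q c₂) = 0 := fun μ => Iff.rfl
  have hm₃ : ∀ μ : Fin 5 → Fin 5 → ℂ, μ ∈ W₃ ↔ μ ∈ W₂ ∧ (fun p q => contractZ μ p q c₃) = 0 := fun μ => Iff.rfl
  have h1 := finrank_le_of_slice_step W W₁ Y₁ c₁ hY₁ (fun μ hμ h0 => (hm₁ μ).mpr ⟨hμ, h0⟩)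
  have h2 := finrank_le_of_slice_step W₁ W₂ Y₂ c₂ (fun μ hμ => hY₂ μ ((hm₁ μ).mp hμ).1 ((hm₁ μ).mp hμ).2)
    (fun μ hμ h0 => (hm₂ μ).mpr ⟨hμ, h0⟩)
  have h3 := finrank_le_of_slice_step W₂ W₃ Y₃ c₃
    (fun μ hμ => hY₃ μ ((hm₁ μ).mp ((hm₂ μ).mp hμ).1).1 ((hm₁ μ).mp ((hm₂ μ).mp hμ).1).2 ((hm₂ μ).mp hμ).2)
    (fun μ hμ h0 => (hm₃ μ).mpr ⟨hμ, h0⟩)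
  -- three vanishing slices kill the obligation
  have hbot : W₃ = ⊥ := by
    refine (Submodule.eq_bot_iff _).mpr fun μ hμ => ?_
    obtain ⟨hμ₂, h₃⟩ := (hm₃ μ).mp hμ
    obtain ⟨hμ₁, h₂⟩ := (hm₂ μ).mp hμ₂
    obtain ⟨hμW, h₁⟩ := (hm₁ μ).mp hμ₁
    have hT := contractZ_eq_zero_of_two_slices μ c₁ c₂ a b c₃ hcov (fun p q => congrFun (congrFun h₁ p) q)
      (fun p q => congrFun (congrFun h₂ p) q) (congrFun (congrFun h₃ a) b)
    exact hub_injective μ (hWs μ hμW) (hWd μ hμW) (fun p q => by simp [hT])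
  have h4 : Module.finrank ℂ W₃ = 0 := by rw [hbot, finrank_bot]
  omega

/-! ### Feeding the chains: a slot all of whose matrices have two or three zero rows -/

/-- ★★ **TWO ZERO ROWS IN `U₀₁`** (e.g. `U₀₁ = ℂu` with `u` supported on three letters; `U₀₂, U₁₂` ARBITRARY symmetric).  If every
matrix of `U₀₁` has rows `c₁, c₂` zero, then `finrank W ≤ finrank Y₁ + finrank Y₂ + 1` for any `Y₁` containing the symmetric
zero-diagonal members of `X = U₀₁ ⊔ U₀₂ ⊔ U₁₂` with row `c₁` zero and any `Y₂` containing those with rows `c₁, c₂` zero. [folklore] -/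
theorem finrank_le_of_two_zero_rows_01 (U01 U02 U12 W Y₁ Y₂ : Submodule ℂ (Fin 5 → Fin 5 → ℂ))
    (h01 : ∀ x ∈ U01, ∀ p q : Fin 5, x p q = x q p) (h02 : ∀ x ∈ U02, ∀ p q : Fin 5, x p q = x q p)
    (h12 : ∀ x ∈ U12, ∀ p q : Fin 5, x p q = x q p)
    (c₁ c₂ a b e : Fin 5) (hcov : ∀ x : Fin 5, x = c₁ ∨ x = c₂ ∨ x = a ∨ x = b ∨ x = e)
    (hr₁ : ∀ x ∈ U01, ∀ q : Fin 5, x c₁ q = 0) (hr₂ : ∀ x ∈ U01, ∀ q : Fin 5, x c₂ q = 0)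
    (hY₁ : ∀ M ∈ U01 ⊔ U02 ⊔ U12, (∀ p q : Fin 5, M p q = M q p) → (∀ p : Fin 5, M p p = 0) →
      (∀ q : Fin 5, M c₁ q = 0) → M ∈ Y₁)
    (hY₂ : ∀ M ∈ U01 ⊔ U02 ⊔ U12, (∀ p q : Fin 5, M p q = M q p) → (∀ p : Fin 5, M p p = 0) →
      (∀ q : Fin 5, M c₁ q = 0) → (∀ q : Fin 5, M c₂ q = 0) → M ∈ Y₂)
    (hWs : ∀ μ ∈ W, ∀ s t : Fin 5, μ s t = μ t s) (hWd : ∀ μ ∈ W, ∀ s : Fin 5, μ s s = 0)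
    (hWc : ∀ μ ∈ W, contractZ μ ∈ L3 U01 U02 U12) :
    Module.finrank ℂ W ≤ Module.finrank ℂ Y₁ + Module.finrank ℂ Y₂ + 1 := by
  refine finrank_le_of_two_slices_chain W Y₁ Y₂ hWs hWd c₁ c₂ a b e hcov (fun μ hμ => ?_) (fun μ hμ h0 => ?_)
  · obtain ⟨hs, hd, hr, -⟩ := sliceCoord_shape μ c₁
    exact hY₁ _ (sliceCoord_mem_01 U01 U02 U12 h01 h02 h12 c₁ hr₁ μ (hWc μ hμ)) hs hd hr
  · obtain ⟨hs, hd, hr, -⟩ := sliceCoord_shape μ c₂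
    exact hY₂ _ (sliceCoord_mem_01 U01 U02 U12 h01 h02 h12 c₂ hr₂ μ (hWc μ hμ)) hs hd
      (sliceCoord_row_eq_zero_of_slice_eq_zero μ c₁ c₂ h0) hr

/-- ★★ **TWO ZERO ROWS IN `U₀₂`.** [folklore] -/
theorem finrank_le_of_two_zero_rows_02 (U01 U02 U12 W Y₁ Y₂ : Submodule ℂ (Fin 5 → Fin 5 → ℂ))
    (h01 : ∀ x ∈ U01, ∀ p q : Fin 5, x p q = x q p) (h02 : ∀ x ∈ U02, ∀ p q : Fin 5, x p q = x q p)
    (h12 : ∀ x ∈ U12, ∀ p q : Fin 5, x p q = x q p)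
    (c₁ c₂ a b e : Fin 5) (hcov : ∀ x : Fin 5, x = c₁ ∨ x = c₂ ∨ x = a ∨ x = b ∨ x = e)
    (hr₁ : ∀ x ∈ U02, ∀ q : Fin 5, x c₁ q = 0) (hr₂ : ∀ x ∈ U02, ∀ q : Fin 5, x c₂ q = 0)
    (hY₁ : ∀ M ∈ U01 ⊔ U02 ⊔ U12, (∀ p q : Fin 5, M p q = M q p) → (∀ p : Fin 5, M p p = 0) →
      (∀ q : Fin 5, M c₁ q = 0) → M ∈ Y₁)
    (hY₂ : ∀ M ∈ U01 ⊔ U02 ⊔ U12, (∀ p q : Fin 5, M p q = M q p) → (∀ p : Fin 5, M p p = 0) →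
      (∀ q : Fin 5, M c₁ q = 0) → (∀ q : Fin 5, M c₂ q = 0) → M ∈ Y₂)
    (hWs : ∀ μ ∈ W, ∀ s t : Fin 5, μ s t = μ t s) (hWd : ∀ μ ∈ W, ∀ s : Fin 5, μ s s = 0)
    (hWc : ∀ μ ∈ W, contractZ μ ∈ L3 U01 U02 U12) :
    Module.finrank ℂ W ≤ Module.finrank ℂ Y₁ + Module.finrank ℂ Y₂ + 1 := by
  refine finrank_le_of_two_slices_chain W Y₁ Y₂ hWs hWd c₁ c₂ a b e hcov (fun μ hμ => ?_) (fun μ hμ h0 => ?_)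
  · obtain ⟨hs, hd, hr, -⟩ := sliceCoord_shape μ c₁
    exact hY₁ _ (sliceCoord_mem_02 U01 U02 U12 h01 h02 h12 c₁ hr₁ μ (hWc μ hμ)) hs hd hr
  · obtain ⟨hs, hd, hr, -⟩ := sliceCoord_shape μ c₂
    exact hY₂ _ (sliceCoord_mem_02 U01 U02 U12 h01 h02 h12 c₂ hr₂ μ (hWc μ hμ)) hs hd
      (sliceCoord_row_eq_zero_of_slice_eq_zero μ c₁ c₂ h0) hr

/-- ★★ **TWO ZERO ROWS IN `U₁₂`.** [folklore] -/
theorem finrank_le_of_two_zero_rows_12 (U01 U02 U12 W Y₁ Y₂ : Submodule ℂ (Fin 5 → Fin 5 → ℂ))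
    (h01 : ∀ x ∈ U01, ∀ p q : Fin 5, x p q = x q p) (h02 : ∀ x ∈ U02, ∀ p q : Fin 5, x p q = x q p)
    (h12 : ∀ x ∈ U12, ∀ p q : Fin 5, x p q = x q p)
    (c₁ c₂ a b e : Fin 5) (hcov : ∀ x : Fin 5, x = c₁ ∨ x = c₂ ∨ x = a ∨ x = b ∨ x = e)
    (hr₁ : ∀ x ∈ U12, ∀ q : Fin 5, x c₁ q = 0) (hr₂ : ∀ x ∈ U12, ∀ q : Fin 5, x c₂ q = 0)
    (hY₁ : ∀ M ∈ U01 ⊔ U02 ⊔ U12, (∀ p q : Fin 5, M p q = M q p) → (∀ p : Fin 5, M p p = 0) →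
      (∀ q : Fin 5, M c₁ q = 0) → M ∈ Y₁)
    (hY₂ : ∀ M ∈ U01 ⊔ U02 ⊔ U12, (∀ p q : Fin 5, M p q = M q p) → (∀ p : Fin 5, M p p = 0) →
      (∀ q : Fin 5, M c₁ q = 0) → (∀ q : Fin 5, M c₂ q = 0) → M ∈ Y₂)
    (hWs : ∀ μ ∈ W, ∀ s t : Fin 5, μ s t = μ t s) (hWd : ∀ μ ∈ W, ∀ s : Fin 5, μ s s = 0)
    (hWc : ∀ μ ∈ W, contractZ μ ∈ L3 U01 U02 U12) :
    Module.finrank ℂ W ≤ Module.finrank ℂ Y₁ + Module.finrank ℂ Y₂ + 1 := by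
  refine finrank_le_of_two_slices_chain W Y₁ Y₂ hWs hWd c₁ c₂ a b e hcov (fun μ hμ => ?_) (fun μ hμ h0 => ?_)
  · obtain ⟨hs, hd, hr, -⟩ := sliceCoord_shape μ c₁
    exact hY₁ _ (sliceCoord_mem_12 U01 U02 U12 h01 h02 h12 c₁ hr₁ μ (hWc μ hμ)) hs hd hr
  · obtain ⟨hs, hd, hr, -⟩ := sliceCoord_shape μ c₂
    exact hY₂ _ (sliceCoord_mem_12 U01 U02 U12 h01 h02 h12 c₂ hr₂ μ (hWc μ hμ)) hs hd
      (sliceCoord_row_eq_zero_of_slice_eq_zero μ c₁ c₂ h0) hr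

/-- ★★ **THREE ZERO ROWS IN `U₀₁`** (e.g. `U₀₁ = ℂu` with `u` supported on a pair of letters `{a, b}`, or `u = x_aa`; `U₀₂, U₁₂`
ARBITRARY).  `finrank W ≤ finrank Y₁ + finrank Y₂ + finrank Y₃`, where `Y₃` only has to contain the symmetric zero-diagonal members of
`X` with rows `c₁, c₂, c₃` zero — the multiples of `x_ab` in `X`, so `Y₃ = ⊥` is admissible when `x_ab ∉ X`.  (For the other two
slots permute with ✓ `contractZ_mem_L3_swap13` / `swap23`.) [folklore] -/
theorem finrank_le_of_three_zero_rows_01 (U01 U02 U12 W Y₁ Y₂ Y₃ : Submodule ℂ (Fin 5 → Fin 5 → ℂ))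
    (h01 : ∀ x ∈ U01, ∀ p q : Fin 5, x p q = x q p) (h02 : ∀ x ∈ U02, ∀ p q : Fin 5, x p q = x q p)
    (h12 : ∀ x ∈ U12, ∀ p q : Fin 5, x p q = x q p)
    (c₁ c₂ c₃ a b : Fin 5) (hcov : ∀ x : Fin 5, x = c₁ ∨ x = c₂ ∨ x = a ∨ x = b ∨ x = c₃)
    (hr₁ : ∀ x ∈ U01, ∀ q : Fin 5, x c₁ q = 0) (hr₂ : ∀ x ∈ U01, ∀ q : Fin 5, x c₂ q = 0)
    (hr₃ : ∀ x ∈ U01, ∀ q : Fin 5, x c₃ q = 0)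
    (hY₁ : ∀ M ∈ U01 ⊔ U02 ⊔ U12, (∀ p q : Fin 5, M p q = M q p) → (∀ p : Fin 5, M p p = 0) →
      (∀ q : Fin 5, M c₁ q = 0) → M ∈ Y₁)
    (hY₂ : ∀ M ∈ U01 ⊔ U02 ⊔ U12, (∀ p q : Fin 5, M p q = M q p) → (∀ p : Fin 5, M p p = 0) →
      (∀ q : Fin 5, M c₁ q = 0) → (∀ q : Fin 5, M c₂ q = 0) → M ∈ Y₂)
    (hY₃ : ∀ M ∈ U01 ⊔ U02 ⊔ U12, (∀ p q : Fin 5, M p q = M q p) → (∀ p : Fin 5, M p p = 0) →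
      (∀ q : Fin 5, M c₁ q = 0) → (∀ q : Fin 5, M c₂ q = 0) → (∀ q : Fin 5, M c₃ q = 0) → M ∈ Y₃)
    (hWs : ∀ μ ∈ W, ∀ s t : Fin 5, μ s t = μ t s) (hWd : ∀ μ ∈ W, ∀ s : Fin 5, μ s s = 0)
    (hWc : ∀ μ ∈ W, contractZ μ ∈ L3 U01 U02 U12) :
    Module.finrank ℂ W ≤ Module.finrank ℂ Y₁ + Module.finrank ℂ Y₂ + Module.finrank ℂ Y₃ := by
  refine finrank_le_of_three_slices_chain W Y₁ Y₂ Y₃ hWs hWd c₁ c₂ c₃ a b hcov (fun μ hμ => ?_) (fun μ hμ h0 => ?_)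
    (fun μ hμ h0 h0' => ?_)
  · obtain ⟨hs, hd, hr, -⟩ := sliceCoord_shape μ c₁
    exact hY₁ _ (sliceCoord_mem_01 U01 U02 U12 h01 h02 h12 c₁ hr₁ μ (hWc μ hμ)) hs hd hr
  · obtain ⟨hs, hd, hr, -⟩ := sliceCoord_shape μ c₂
    exact hY₂ _ (sliceCoord_mem_01 U01 U02 U12 h01 h02 h12 c₂ hr₂ μ (hWc μ hμ)) hs hd
      (sliceCoord_row_eq_zero_of_slice_eq_zero μ c₁ c₂ h0) hr
  · obtain ⟨hs, hd, hr, -⟩ := sliceCoord_shape μ c₃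
    exact hY₃ _ (sliceCoord_mem_01 U01 U02 U12 h01 h02 h12 c₃ hr₃ μ (hWc μ hμ)) hs hd
      (sliceCoord_row_eq_zero_of_slice_eq_zero μ c₁ c₃ h0) (sliceCoord_row_eq_zero_of_slice_eq_zero μ c₂ c₃ h0') hr

/-- ★ **BOOKKEEPING FORM**: `CaptureIneqSym` for a slot `U₀₁` with two zero rows as soon as the chain bound fits under `Σ finrank`.
[folklore] -/
theorem captureIneqSym_of_two_zero_rows_01 (U01 U02 U12 W Y₁ Y₂ : Submodule ℂ (Fin 5 → Fin 5 → ℂ))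
    (h01 : ∀ x ∈ U01, ∀ p q : Fin 5, x p q = x q p) (h02 : ∀ x ∈ U02, ∀ p q : Fin 5, x p q = x q p)
    (h12 : ∀ x ∈ U12, ∀ p q : Fin 5, x p q = x q p)
    (c₁ c₂ a b e : Fin 5) (hcov : ∀ x : Fin 5, x = c₁ ∨ x = c₂ ∨ x = a ∨ x = b ∨ x = e)
    (hr₁ : ∀ x ∈ U01, ∀ q : Fin 5, x c₁ q = 0) (hr₂ : ∀ x ∈ U01, ∀ q : Fin 5, x c₂ q = 0)
    (hY₁ : ∀ M ∈ U01 ⊔ U02 ⊔ U12, (∀ p q : Fin 5, M p q = M q p) → (∀ p : Fin 5, M p p = 0) →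
      (∀ q : Fin 5, M c₁ q = 0) → M ∈ Y₁)
    (hY₂ : ∀ M ∈ U01 ⊔ U02 ⊔ U12, (∀ p q : Fin 5, M p q = M q p) → (∀ p : Fin 5, M p p = 0) →
      (∀ q : Fin 5, M c₁ q = 0) → (∀ q : Fin 5, M c₂ q = 0) → M ∈ Y₂)
    (hle : Module.finrank ℂ Y₁ + Module.finrank ℂ Y₂ + 1 ≤ Module.finrank ℂ U01 + Module.finrank ℂ U02 + Module.finrank ℂ U12)
    (hWs : ∀ μ ∈ W, ∀ s t : Fin 5, μ s t = μ t s) (hWd : ∀ μ ∈ W, ∀ s : Fin 5, μ s s = 0)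
    (hWc : ∀ μ ∈ W, contractZ μ ∈ L3 U01 U02 U12) :
    Module.finrank ℂ W ≤ Module.finrank ℂ U01 + Module.finrank ℂ U02 + Module.finrank ℂ U12 :=
  (finrank_le_of_two_zero_rows_01 U01 U02 U12 W Y₁ Y₂ h01 h02 h12 c₁ c₂ a b e hcov hr₁ hr₂ hY₁ hY₂ hWs hWd hWc).trans hle

end LaplaceFiveSeparatedCapture

end Summit.ValiantsHypothesis.ValiantsHypothesis.Theorems.RigidityForcesSymmetryRankRigidMinimalRepr
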